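import Summits.QuantumFields.BalabanUV.Beta.GAN24.FineReadoutCauchyDec
import Summits.QuantumFields.BalabanUV.Beta.GAN24.ScaleNesting

/-!
# `BalabanUV.Beta.GAN24.FineReadoutCauchyDecLegs` — binder row G-an2-4 / (CONV-C), S-slot, road «S3»: «(N1-Cauchy)» IN THE FORMS THE DIFF
# ROWS CONSUME, part 2 — ALL MEMBERS from the cell-MEAN statement + the TREE's (N1′), and the three `Lc`-DECIMATED LEG DIFFERENCES at `d = 3`
# (generic leaf «N1-CAUCHY-DEC*», an ADAPTER; b2b-balaban-gan24-formalise-leaf-19, gen 15; part 1 = `GAN24/FineReadoutCauchyDec`)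

NOT IN PRINT; OUR PROOF ATTEMPT.  HONEST FRAMING (cell contract, verbatim): «discharging `BetaPertH` makes Bałaban's UV stability
UNCONDITIONAL — a real constructive-QFT result; it is NOT the continuum limit and NOT the Clay problem.»  HONEST DEPENDENCY (verbatim):
«continuum YM on T⁴ ⇐ BetaPertH ∧ nine spine estimates (0/9 proved); BetaPertH ⇐ (D1) ∧ (D4) ∧ CAP+tail; G-an2-4 gates asym, D1 and
NE2/3/4.»  [folklore] bookkeeping over part 1 and the TREE's (N1′) `FineReadoutGradientDecay.exists_wH_grad_decay` (generic `d`, leaf-18's (N1′),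
UNCONDITIONAL); the owner's CELL-MEAN statement of «(N1-Cauchy)» (`HOME/b2b-balaban-gan24-p1/N1-CAUCHY-SPEC.md` §1) is a HYPOTHESIS `hC` (no
`def … : Prop`, no cited fact, no wall binder) — at `d = 3` LITERALLY the conclusion of leaf-13's TREE
`FineReadoutCauchyReal.exists_wH_cellMean_cauchy_three_of_puncturedRate` / of the holder's END `GAN24/FineReadoutCauchy.exists_wH_cellMean_cauchy`
(leaf-17 lineage), discharged BY NAME by the consumer when that END lands.  Discharges NOTHING of «(N1-Cauchy)», of «E3SupRate»/«E3Shape», of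
(hS, hSall) by itself; moves no row (ref2 (h)); NOT BetaPertH, NOT continuum, NOT Clay.

## What is proved
* §3 (generic `d`, `2 ≤ Lc`): **`exists_cauchy_forms_of_cellMean`** (master package, (P) ∧ (D)), **`exists_sample_cauchy_of_cellMean`** (P: every sample
  `H̃_{Lc^(n+2)}(Lc•z + v)`, `|v|₁ ≤ 2(d+1)·Lc`), **`exists_wavg_cauchy_of_cellMean`** (W: finite weighted averages of such samples — shifted cell
  means, straight-contour means), **`exists_dec_cauchy_of_cellMean`** (D: the `dec Lc` block-contour mean of EVERY leg type `a : Fib d` —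
  `Σ_{i ∈ legSet d Lc a} legW d Lc a · H̃_{Lc^(n+2)}(legPt Lc a z i)`, the leg weights of `OneStepKernelFamily.dec` / `InterLevelTransport.avgLift`
  EXACTLY, no weight-defect remainder), **`exists_blockSample_cauchy_of_cellMean`** (S: `H̃_{Lc^(n+2)}(w)` against `H̃_{Lc^(n+1)}(quo Lc w)` — the
  dW row's coupling shape), all against `H̃_{Lc^(n+1)}` within `c′·θ′^n·e^{−κ′|quo_{Lc^(n+1)} ·|₁}`, ONE
  `(c′, θ′, κ′) = (c + 3(d+1)Lc·C′·e^{3κ₀Lc}, max θ Lc⁻¹, min κ₁ (κ₀/(d+1)))` (`(c, θ, κ₁)` of `hC`, `(κ₀, C′)` of (N1′)).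
* §4 (`d = 3`, ROW indexing — member `n+2` at `N = Lc^(n+1+1)`, member `n+3` at `N′ = Lc^(n+1+1+1)`, rate `θ′^(n+1)`):
  **`decLegs_three_of_cellMean`** — in `StencilSlotE3HLeg.legs_three`'s block-ℓ¹ currency, the literal one-step differences of the hypotheses
  hH/hB (vertex `u − N•u′` / right `y − N•z′`) and hA (left, `GamΦ` via `ResolventComposition.GamΦ_eq_neg_wH`) of `TaylorSandwich.sandwich_bound`,
  member `n+3`'s legs `Lc`-decimated (its outer tsums re-indexed coset by coset over member `n+2`'s lattice — leaf-08-g11's alignment,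
  CLAIMS l.5351 (1)) against member `n+2`'s; **`sampleLegs_three_of_cellMean`** — the same three legs BLOCK-SAMPLED (member `n+3`'s leg at the
  fine site against member `n+2`'s at its `Lc`-block, weight `e^{−κ′|quo_{N′} u − u′|₁}`: the dW row's three couplings, leaf-15-g14 CLAIMS l.5425).
Unit `b2b-balaban-gan24-formalise-leaf-19` (gen 15), 2026-08-20.
-/

noncomputable section

open Finset
open scoped BigOperators
open Literature.MathematicalPhysics.QuantumFieldTheory
open Literature.MathematicalPhysics.QuantumFieldTheory.Balaban1983to89
open Literature.MathematicalPhysics.QuantumFieldTheory.Balaban1983to89.Beta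
open Literature.MathematicalPhysics.QuantumFieldTheory.LatticeForm (quo)
open B12Sec2to5 (l1 l1_nonneg)
open B4ContourShift (supNorm supNorm_nonneg)
open ExpKernelCalculus (l1_sub_symm)
open AffineAveraging (box toSite)
open KernelSpecInstance (wH)
open KKTFluctuationKernel (GamΦ)
open ResolventComposition (GamΦ_eq_neg_wH)
open OneStepResolventKernel (Fib)
open OneStepKernelFamily (legSet legPt legW legPt_add)
open Summit.QuantumFields.BalabanUV.Beta.GAN24.CombesThomasFibre (quo_sub_zsmul)
open Summit.QuantumFields.BalabanUV.Beta.GAN24.ScaleNesting (quo_mul)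
open BalabanCompositeJets (l1_sub_zsmul_quo_le)
open Summit.QuantumFields.BalabanUV.Beta.GAN24.FineReadoutGradientDecay (exists_wH_grad_decay)

open Summit.QuantumFields.BalabanUV.Beta.GAN24.FineReadoutCauchyDec (abs_sample_sub_le_wH abs_dec_sub_le_wH)

namespace Summit.QuantumFields.BalabanUV.Beta.GAN24.FineReadoutCauchyDecLegs

variable {d : ℕ}

/-! ## §3 All members: the packaged forms from the cell-MEAN «(N1-Cauchy)» and the TREE's (N1′) -/

section AllLevels

variable {Lc : ℕ} [NeZero Lc]

/-- [folklore] Weakening a rate: `e^{−κ s} ≤ e^{−κ′ s}` for `κ′ ≤ κ`, `s ≥ 0` (the `-κ * s` spelling). -/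
theorem exp_negMul_le_of_le {κ κ' s : ℝ} (h : κ' ≤ κ) (hs : 0 ≤ s) : Real.exp (-κ * s) ≤ Real.exp (-κ' * s) := by
  rw [Real.exp_le_exp]; nlinarith

omit [NeZero Lc] in
/-- [folklore] `(Lc^(n+2))⁻¹ ≤ (Lc⁻¹)^n` for `Lc ≥ 1`. -/
theorem inv_pow_succ_succ_le (hLc : 1 ≤ Lc) (n : ℕ) : ((Lc : ℝ) ^ (n + 2))⁻¹ ≤ ((Lc : ℝ)⁻¹) ^ n := by
  have hL : (1 : ℝ) ≤ Lc := by exact_mod_cast hLc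
  have hLpos : (0 : ℝ) < Lc := by linarith
  rw [← inv_pow]
  exact pow_le_pow_of_le_one (inv_nonneg.2 hLpos.le) (inv_le_one_of_one_le₀ hL) (by omega)

/-- [folklore] **THE MASTER PACKAGE** (generic `d`, `Lc ≥ 2`).  From the cell-MEAN statement of «(N1-Cauchy)» (owner's §1 shape, constants `(c, θ, κ₁)`,
a HYPOTHESIS) and the TREE's (N1′) `FineReadoutGradientDecay.exists_wH_grad_decay`: ONE `(c′, θ′, κ′)` with `0 ≤ c′`, `0 ≤ θ′ < 1`, `0 < κ′` such that, for
every member `n`, directions `κ l`, fine site `z`:  (P) every sample `H̃_{Lc^(n+2)}(Lc•z + v)`, `|v|₁ ≤ 2(d+1)·Lc`, and (D) every `dec Lc` block-contour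
mean `Σ_{i ∈ legSet d Lc a} legW d Lc a · H̃_{Lc^(n+2)}(legPt Lc a z i)` (any leg type `a`) is within `c′·θ′^n·e^{−κ′|quo_{Lc^(n+1)} z|₁}` of
`H̃_{Lc^(n+1)}(z)`.  Constants: `θ′ = max θ Lc⁻¹`, `κ′ = min κ₁ (κ₀/(d+1))`, `c′ = c + 3(d+1)Lc·C′·e^{3κ₀Lc}` (`(κ₀, C′)` of (N1′)). -/
theorem exists_cauchy_forms_of_cellMean (hLc : 2 ≤ Lc) {c θ κ₁ : ℝ} (hc : 0 ≤ c) (hθ0 : 0 ≤ θ) (hθ1 : θ < 1)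
    (hκ₁ : 0 < κ₁)
    (hC : ∀ (n : ℕ) (κ l : Fin (d + 1)) (z : Fin (d + 1) → ℤ),
      |((Lc : ℝ) ^ (d + 1))⁻¹ * ∑ r ∈ box (d + 1) Lc,
            ((Lc : ℝ) ^ (n + 2)) ^ (d + 2) * wH (N := Lc ^ (n + 2)) κ l ((Lc : ℤ) • z + toSite r) -
          ((Lc : ℝ) ^ (n + 1)) ^ (d + 2) * wH (N := Lc ^ (n + 1)) κ l z| ≤
        c * θ ^ n * Real.exp (-κ₁ * l1 (quo (Lc ^ (n + 1)) z))) :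
    ∃ c' θ' κ' : ℝ, 0 ≤ c' ∧ 0 ≤ θ' ∧ θ' < 1 ∧ 0 < κ' ∧
      (∀ (n : ℕ) (κ l : Fin (d + 1)) (z v : Fin (d + 1) → ℤ), l1 v ≤ 2 * (d + 1) * Lc →
        |((Lc : ℝ) ^ (n + 2)) ^ (d + 2) * wH (N := Lc ^ (n + 2)) κ l ((Lc : ℤ) • z + v) -
            ((Lc : ℝ) ^ (n + 1)) ^ (d + 2) * wH (N := Lc ^ (n + 1)) κ l z|
          ≤ c' * θ' ^ n * Real.exp (-κ' * l1 (quo (Lc ^ (n + 1)) z))) ∧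
      (∀ (n : ℕ) (κ l : Fin (d + 1)) (z : Fin (d + 1) → ℤ) (a : Fib d),
        |∑ i ∈ legSet d Lc a, legW d Lc a * (((Lc : ℝ) ^ (n + 2)) ^ (d + 2) * wH (N := Lc ^ (n + 2)) κ l (legPt Lc a z i)) -
            ((Lc : ℝ) ^ (n + 1)) ^ (d + 2) * wH (N := Lc ^ (n + 1)) κ l z|
          ≤ c' * θ' ^ n * Real.exp (-κ' * l1 (quo (Lc ^ (n + 1)) z))) := by
  obtain ⟨κ₀, C', hκ₀, hC', hN1'⟩ := exists_wH_grad_decay (d := d) (Lc := Lc)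
  have hLc1 : 1 ≤ Lc := le_trans (by norm_num) hLc
  have hLr : (1 : ℝ) < Lc := by exact_mod_cast (lt_of_lt_of_le (by norm_num) hLc : 1 < Lc)
  have hLpos : (0 : ℝ) < Lc := by linarith
  set δ : ℝ := κ₀ / ((d : ℝ) + 1) with hδ
  have hδ0 : 0 ≤ δ := by rw [hδ]; exact div_nonneg hκ₀.le (by positivity)
  have hδpos : 0 < δ := by rw [hδ]; exact div_pos hκ₀ (by positivity)
  set R : ℝ := 3 * (d + 1) * Lc with hR
  have hR0 : 0 ≤ R := by rw [hR]; positivity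
  set A : ℝ := R * C' * Real.exp (δ * R) with hA
  have hA0 : 0 ≤ A := by rw [hA]; positivity
  set θ' : ℝ := max θ ((Lc : ℝ)⁻¹) with hθ'
  have hθ'0 : 0 ≤ θ' := hθ0.trans (le_max_left _ _)
  have hθ'1 : θ' < 1 := max_lt hθ1 (inv_lt_one_of_one_lt₀ hLr)
  set κ' : ℝ := min κ₁ δ with hκ'
  have hκ'pos : 0 < κ' := lt_min hκ₁ hδpos
  -- the common real step: ε-term + gradient-term ≤ (c + A)·θ′^n·e^{−κ′ s}
  have key : ∀ (n : ℕ) (s : ℝ), 0 ≤ s →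
      c * θ ^ n * Real.exp (-κ₁ * s) + R * (C' * ((Lc : ℝ) ^ (n + 2))⁻¹) * Real.exp (δ * R) * Real.exp (-δ * s)
        ≤ (c + A) * θ' ^ n * Real.exp (-κ' * s) := by
    intro n s hs
    have h1 : θ ^ n ≤ θ' ^ n := pow_le_pow_left₀ hθ0 (le_max_left _ _) n
    have h2 : ((Lc : ℝ) ^ (n + 2))⁻¹ ≤ θ' ^ n :=
      (inv_pow_succ_succ_le hLc1 n).trans (pow_le_pow_left₀ (inv_nonneg.2 hLpos.le) (le_max_right _ _) n)
    have h3 : Real.exp (-κ₁ * s) ≤ Real.exp (-κ' * s) := exp_negMul_le_of_le (min_le_left _ _) hs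
    have h4 : Real.exp (-δ * s) ≤ Real.exp (-κ' * s) := exp_negMul_le_of_le (min_le_right _ _) hs
    have hE : 0 ≤ Real.exp (-κ' * s) := (Real.exp_pos _).le
    have hθn : 0 ≤ θ' ^ n := pow_nonneg hθ'0 n
    have t1 : c * θ ^ n * Real.exp (-κ₁ * s) ≤ c * θ' ^ n * Real.exp (-κ' * s) :=
      mul_le_mul (mul_le_mul_of_nonneg_left h1 hc) h3 (Real.exp_pos _).le (mul_nonneg hc hθn)
    have t2 : R * (C' * ((Lc : ℝ) ^ (n + 2))⁻¹) * Real.exp (δ * R) * Real.exp (-δ * s) ≤ A * θ' ^ n * Real.exp (-κ' * s) := by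
      have e : R * (C' * ((Lc : ℝ) ^ (n + 2))⁻¹) * Real.exp (δ * R) = A * ((Lc : ℝ) ^ (n + 2))⁻¹ := by rw [hA]; ring
      rw [e]
      exact mul_le_mul (mul_le_mul_of_nonneg_left h2 hA0) h4 (Real.exp_pos _).le (mul_nonneg hA0 hθn)
    calc _ ≤ c * θ' ^ n * Real.exp (-κ' * s) + A * θ' ^ n * Real.exp (-κ' * s) := add_le_add t1 t2
      _ = (c + A) * θ' ^ n * Real.exp (-κ' * s) := by ring
  refine ⟨c + A, θ', κ', add_nonneg hc hA0, hθ'0, hθ'1, hκ'pos, fun n κ l z v hv => ?_, fun n κ l z a => ?_⟩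
  · have hvR : l1 v + (d + 1) * Lc ≤ R := by
      rw [hR]; have : (0 : ℝ) ≤ (d + 1) * Lc := by positivity
      linarith
    exact (abs_sample_sub_le_wH hκ₀.le hC' hN1' n κ l z (hC n κ l z) hvR).trans (key n _ (l1_nonneg _))
  · exact (abs_dec_sub_le_wH hκ₀.le hC' hN1' n κ l z (hC n κ l z) a).trans (key n _ (l1_nonneg _))

/-- [folklore] **(P) POINTWISE SAMPLES** — projection of the master package. -/
theorem exists_sample_cauchy_of_cellMean (hLc : 2 ≤ Lc) {c θ κ₁ : ℝ} (hc : 0 ≤ c) (hθ0 : 0 ≤ θ) (hθ1 : θ < 1)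
    (hκ₁ : 0 < κ₁)
    (hC : ∀ (n : ℕ) (κ l : Fin (d + 1)) (z : Fin (d + 1) → ℤ),
      |((Lc : ℝ) ^ (d + 1))⁻¹ * ∑ r ∈ box (d + 1) Lc,
            ((Lc : ℝ) ^ (n + 2)) ^ (d + 2) * wH (N := Lc ^ (n + 2)) κ l ((Lc : ℤ) • z + toSite r) -
          ((Lc : ℝ) ^ (n + 1)) ^ (d + 2) * wH (N := Lc ^ (n + 1)) κ l z| ≤
        c * θ ^ n * Real.exp (-κ₁ * l1 (quo (Lc ^ (n + 1)) z))) :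
    ∃ c' θ' κ' : ℝ, 0 ≤ c' ∧ 0 ≤ θ' ∧ θ' < 1 ∧ 0 < κ' ∧
      ∀ (n : ℕ) (κ l : Fin (d + 1)) (z v : Fin (d + 1) → ℤ), l1 v ≤ 2 * (d + 1) * Lc →
        |((Lc : ℝ) ^ (n + 2)) ^ (d + 2) * wH (N := Lc ^ (n + 2)) κ l ((Lc : ℤ) • z + v) -
            ((Lc : ℝ) ^ (n + 1)) ^ (d + 2) * wH (N := Lc ^ (n + 1)) κ l z|
          ≤ c' * θ' ^ n * Real.exp (-κ' * l1 (quo (Lc ^ (n + 1)) z)) := by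
  obtain ⟨c', θ', κ', h0, h1, h2, h3, hP, _⟩ := exists_cauchy_forms_of_cellMean (d := d) hLc hc hθ0 hθ1 hκ₁ hC
  exact ⟨c', θ', κ', h0, h1, h2, h3, hP⟩

/-- [folklore] **(W) WEIGHTED AVERAGES OF SAMPLES** (weights `≥ 0` summing to `1`, offsets `|v i|₁ ≤ 2(d+1)·Lc`; the shifted cell means
`Lc•z + t•e_κ + box`, `t < Lc`, and the straight-contour means are instances) — from (P) by convexity. -/
theorem exists_wavg_cauchy_of_cellMean (hLc : 2 ≤ Lc) {c θ κ₁ : ℝ} (hc : 0 ≤ c) (hθ0 : 0 ≤ θ) (hθ1 : θ < 1)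
    (hκ₁ : 0 < κ₁)
    (hC : ∀ (n : ℕ) (κ l : Fin (d + 1)) (z : Fin (d + 1) → ℤ),
      |((Lc : ℝ) ^ (d + 1))⁻¹ * ∑ r ∈ box (d + 1) Lc,
            ((Lc : ℝ) ^ (n + 2)) ^ (d + 2) * wH (N := Lc ^ (n + 2)) κ l ((Lc : ℤ) • z + toSite r) -
          ((Lc : ℝ) ^ (n + 1)) ^ (d + 2) * wH (N := Lc ^ (n + 1)) κ l z| ≤
        c * θ ^ n * Real.exp (-κ₁ * l1 (quo (Lc ^ (n + 1)) z))) :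
    ∃ c' θ' κ' : ℝ, 0 ≤ c' ∧ 0 ≤ θ' ∧ θ' < 1 ∧ 0 < κ' ∧
      ∀ (n : ℕ) (κ l : Fin (d + 1)) (z : Fin (d + 1) → ℤ) (S : Finset ((Fin (d + 1) → ℕ) × ℕ))
        (w : ((Fin (d + 1) → ℕ) × ℕ) → ℝ) (v : ((Fin (d + 1) → ℕ) × ℕ) → (Fin (d + 1) → ℤ)),
        (∀ i ∈ S, 0 ≤ w i) → ∑ i ∈ S, w i = 1 → (∀ i ∈ S, l1 (v i) ≤ 2 * (d + 1) * Lc) →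
        |∑ i ∈ S, w i * (((Lc : ℝ) ^ (n + 2)) ^ (d + 2) * wH (N := Lc ^ (n + 2)) κ l ((Lc : ℤ) • z + v i)) -
            ((Lc : ℝ) ^ (n + 1)) ^ (d + 2) * wH (N := Lc ^ (n + 1)) κ l z|
          ≤ c' * θ' ^ n * Real.exp (-κ' * l1 (quo (Lc ^ (n + 1)) z)) := by
  obtain ⟨c', θ', κ', h0, h1, h2, h3, hP⟩ := exists_sample_cauchy_of_cellMean (d := d) hLc hc hθ0 hθ1 hκ₁ hC
  refine ⟨c', θ', κ', h0, h1, h2, h3, fun n κ l z S w v hw0 hw1 hv => ?_⟩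
  set f : ℝ := ((Lc : ℝ) ^ (n + 1)) ^ (d + 2) * wH (N := Lc ^ (n + 1)) κ l z with hf
  set K : ℝ := c' * θ' ^ n * Real.exp (-κ' * l1 (quo (Lc ^ (n + 1)) z)) with hK
  have e : ∑ i ∈ S, w i * (((Lc : ℝ) ^ (n + 2)) ^ (d + 2) * wH (N := Lc ^ (n + 2)) κ l ((Lc : ℤ) • z + v i)) - f =
      ∑ i ∈ S, w i * (((Lc : ℝ) ^ (n + 2)) ^ (d + 2) * wH (N := Lc ^ (n + 2)) κ l ((Lc : ℤ) • z + v i) - f) := by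
    simp only [mul_sub, Finset.sum_sub_distrib, ← Finset.sum_mul, hw1, one_mul]
  rw [e]
  calc |∑ i ∈ S, w i * (((Lc : ℝ) ^ (n + 2)) ^ (d + 2) * wH (N := Lc ^ (n + 2)) κ l ((Lc : ℤ) • z + v i) - f)|
      ≤ ∑ i ∈ S, |w i * (((Lc : ℝ) ^ (n + 2)) ^ (d + 2) * wH (N := Lc ^ (n + 2)) κ l ((Lc : ℤ) • z + v i) - f)| :=
        Finset.abs_sum_le_sum_abs _ _
    _ ≤ ∑ i ∈ S, w i * K := by
        refine Finset.sum_le_sum fun i hi => ?_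
        rw [abs_mul, abs_of_nonneg (hw0 i hi)]
        exact mul_le_mul_of_nonneg_left (hP n κ l z (v i) (hv i hi)) (hw0 i hi)
    _ = K := by rw [← Finset.sum_mul, hw1, one_mul]

/-- [folklore] **(D) THE `dec Lc` BLOCK-CONTOUR MEANS** (every leg type `a : Fib d`; the leg weights of `OneStepKernelFamily.dec` /
`InterLevelTransport.avgLift` EXACTLY — no weight-defect remainder) — projection of the master package. -/
theorem exists_dec_cauchy_of_cellMean (hLc : 2 ≤ Lc) {c θ κ₁ : ℝ} (hc : 0 ≤ c) (hθ0 : 0 ≤ θ) (hθ1 : θ < 1)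
    (hκ₁ : 0 < κ₁)
    (hC : ∀ (n : ℕ) (κ l : Fin (d + 1)) (z : Fin (d + 1) → ℤ),
      |((Lc : ℝ) ^ (d + 1))⁻¹ * ∑ r ∈ box (d + 1) Lc,
            ((Lc : ℝ) ^ (n + 2)) ^ (d + 2) * wH (N := Lc ^ (n + 2)) κ l ((Lc : ℤ) • z + toSite r) -
          ((Lc : ℝ) ^ (n + 1)) ^ (d + 2) * wH (N := Lc ^ (n + 1)) κ l z| ≤
        c * θ ^ n * Real.exp (-κ₁ * l1 (quo (Lc ^ (n + 1)) z))) :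
    ∃ c' θ' κ' : ℝ, 0 ≤ c' ∧ 0 ≤ θ' ∧ θ' < 1 ∧ 0 < κ' ∧
      ∀ (n : ℕ) (κ l : Fin (d + 1)) (z : Fin (d + 1) → ℤ) (a : Fib d),
        |∑ i ∈ legSet d Lc a, legW d Lc a * (((Lc : ℝ) ^ (n + 2)) ^ (d + 2) * wH (N := Lc ^ (n + 2)) κ l (legPt Lc a z i)) -
            ((Lc : ℝ) ^ (n + 1)) ^ (d + 2) * wH (N := Lc ^ (n + 1)) κ l z|
          ≤ c' * θ' ^ n * Real.exp (-κ' * l1 (quo (Lc ^ (n + 1)) z)) := by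
  obtain ⟨c', θ', κ', h0, h1, h2, h3, _, hD⟩ := exists_cauchy_forms_of_cellMean (d := d) hLc hc hθ0 hθ1 hκ₁ hC
  exact ⟨c', θ', κ', h0, h1, h2, h3, hD⟩


/-- [folklore] **(S) SAMPLES AGAINST THE BLOCK LABEL** (the dW row's coupling shape, leaf-15-g14 CLAIMS l.5425: `|G₁ l w − G l (quo Lc w)| ≤ ε_n·e^{−δ|…|₁}`):
every fine site `w` of the next level against its `Lc`-block `quo Lc w` — (P) at `z := quo Lc w`, `v := w − Lc•quo Lc w` (`|v|₁ ≤ (d+1)·Lc`,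
`BalabanCompositeJets.l1_sub_zsmul_quo_le`). -/
theorem exists_blockSample_cauchy_of_cellMean (hLc : 2 ≤ Lc) {c θ κ₁ : ℝ} (hc : 0 ≤ c) (hθ0 : 0 ≤ θ) (hθ1 : θ < 1)
    (hκ₁ : 0 < κ₁)
    (hC : ∀ (n : ℕ) (κ l : Fin (d + 1)) (z : Fin (d + 1) → ℤ),
      |((Lc : ℝ) ^ (d + 1))⁻¹ * ∑ r ∈ box (d + 1) Lc,
            ((Lc : ℝ) ^ (n + 2)) ^ (d + 2) * wH (N := Lc ^ (n + 2)) κ l ((Lc : ℤ) • z + toSite r) -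
          ((Lc : ℝ) ^ (n + 1)) ^ (d + 2) * wH (N := Lc ^ (n + 1)) κ l z| ≤
        c * θ ^ n * Real.exp (-κ₁ * l1 (quo (Lc ^ (n + 1)) z))) :
    ∃ c' θ' κ' : ℝ, 0 ≤ c' ∧ 0 ≤ θ' ∧ θ' < 1 ∧ 0 < κ' ∧
      ∀ (n : ℕ) (κ l : Fin (d + 1)) (w : Fin (d + 1) → ℤ),
        |((Lc : ℝ) ^ (n + 2)) ^ (d + 2) * wH (N := Lc ^ (n + 2)) κ l w -
            ((Lc : ℝ) ^ (n + 1)) ^ (d + 2) * wH (N := Lc ^ (n + 1)) κ l (quo Lc w)|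
          ≤ c' * θ' ^ n * Real.exp (-κ' * l1 (quo (Lc ^ (n + 1)) (quo Lc w))) := by
  obtain ⟨c', θ', κ', h0, h1, h2, h3, hP⟩ := exists_sample_cauchy_of_cellMean (d := d) hLc hc hθ0 hθ1 hκ₁ hC
  refine ⟨c', θ', κ', h0, h1, h2, h3, fun n κ l w => ?_⟩
  have hv : l1 (w - (Lc : ℤ) • quo Lc w) ≤ 2 * (d + 1) * Lc := by
    have h := l1_sub_zsmul_quo_le Lc w
    have : (0 : ℝ) ≤ (d + 1) * Lc := by positivity
    linarith
  have h := hP n κ l (quo Lc w) (w - (Lc : ℤ) • quo Lc w) hv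
  rwa [add_sub_cancel] at h

end AllLevels

/-! ## §4 `d = 3`: the one-step differences of the three legs of `TaylorSandwich.sandwich_bound`, member `n+3` `Lc`-decimated against member `n+2` -/

section Three

variable {Lc : ℕ} [NeZero Lc]

omit [NeZero Lc] in
/-- [folklore] Leg points commute with the coarse shift: `legPt Lc a (u − N•u′) i = legPt Lc a u i − (N·Lc)•u′`, casts as in the rows
(`N = Lc^(n+2)`, `N·Lc = Lc^(n+3)`). -/
theorem legPt_sub_zsmul (a : Fib 3) (n : ℕ) (u u' : Fin (3 + 1) → ℤ) (i : (Fin (3 + 1) → ℕ) × ℕ) :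
    legPt Lc a (u - (((Lc ^ (n + 1 + 1) : ℕ) : ℤ)) • u') i =
      legPt Lc a u i - (((Lc ^ (n + 1 + 1 + 1) : ℕ) : ℤ)) • u' := by
  rw [sub_eq_add_neg, legPt_add, ← smul_neg, smul_smul, smul_neg, ← sub_eq_add_neg]
  congr 2
  push_cast
  ring

/-- [folklore] **THE THREE DECIMATED LEG DIFFERENCES AT `d = 3`** (ROW indexing: member `n+2` at `N = Lc^(n+1+1)`, member `n+3` at `N′ = Lc^(n+1+1+1)`;
`Lc ≥ 2`).  From the cell-MEAN «(N1-Cauchy)» at `d = 3` (owner's §1 shape — at `d = 3` LITERALLY the conclusion of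
`FineReadoutCauchyReal.exists_wH_cellMean_cauchy_three_of_puncturedRate` / of the END `GAN24/FineReadoutCauchy.exists_wH_cellMean_cauchy`,
a HYPOTHESIS here) and the TREE's (N1′): ONE `(c′, θ′, κ′)` such that, in `StencilSlotE3HLeg.legs_three`'s block-ℓ¹ currency,
(vertex/right) `|Σ_{i ∈ legSet 3 Lc (inl k)} legW·N′^5·wH_{N′} k l (legPt Lc (inl k) u i − N′•u′) − N^5·wH_N k l (u − N•u′)| ≤ c′·θ′^{n+1}·e^{−κ′|quo_N u − u′|₁}`
and (left) `|Σ_{i ∈ legSet 3 Lc (inl l)} legW·N′^5·GamΦ_{N′} α x′ l (legPt Lc (inl l) w i) − N^5·GamΦ_N α x′ l w| ≤ c′·θ′^{n+1}·e^{−κ′|x′ − quo_N w|₁}`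
— the literal one-step differences of the hypotheses hH/hB and hA of `TaylorSandwich.sandwich_bound` when member `n+3`'s outer tsums are
re-indexed coset by coset over member `n+2`'s lattice (leaf-08-g11's alignment, CLAIMS l.5351 (1)). -/
theorem decLegs_three_of_cellMean (hLc : 2 ≤ Lc) {c θ κ₁ : ℝ} (hc : 0 ≤ c) (hθ0 : 0 ≤ θ) (hθ1 : θ < 1) (hκ₁ : 0 < κ₁)
    (hC : ∀ (n : ℕ) (κ l : Fin (3 + 1)) (z : Fin (3 + 1) → ℤ),
      |((Lc : ℝ) ^ (3 + 1))⁻¹ * ∑ r ∈ box (3 + 1) Lc,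
            ((Lc : ℝ) ^ (n + 2)) ^ (3 + 2) * wH (N := Lc ^ (n + 2)) κ l ((Lc : ℤ) • z + toSite r) -
          ((Lc : ℝ) ^ (n + 1)) ^ (3 + 2) * wH (N := Lc ^ (n + 1)) κ l z| ≤
        c * θ ^ n * Real.exp (-κ₁ * l1 (quo (Lc ^ (n + 1)) z))) :
    ∃ c' θ' κ' : ℝ, 0 ≤ c' ∧ 0 ≤ θ' ∧ θ' < 1 ∧ 0 < κ' ∧
      (∀ (n : ℕ) (k l : Fin (3 + 1)) (u u' : Fin (3 + 1) → ℤ),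
        |∑ i ∈ legSet 3 Lc (Sum.inl k), legW 3 Lc (Sum.inl k) *
              (((Lc : ℝ) ^ (n + 1 + 1 + 1)) ^ (3 + 2) *
                wH (N := Lc ^ (n + 1 + 1 + 1)) k l (legPt Lc (Sum.inl k) u i - (((Lc ^ (n + 1 + 1 + 1) : ℕ) : ℤ)) • u')) -
            ((Lc : ℝ) ^ (n + 1 + 1)) ^ (3 + 2) * wH (N := Lc ^ (n + 1 + 1)) k l (u - (((Lc ^ (n + 1 + 1) : ℕ) : ℤ)) • u')|
          ≤ c' * θ' ^ (n + 1) * Real.exp (-κ' * l1 (quo (Lc ^ (n + 1 + 1)) u - u'))) ∧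
      (∀ (n : ℕ) (α l : Fin (3 + 1)) (x' w : Fin (3 + 1) → ℤ),
        |∑ i ∈ legSet 3 Lc (Sum.inl l), legW 3 Lc (Sum.inl l) *
              (((Lc : ℝ) ^ (n + 1 + 1 + 1)) ^ (3 + 2) * GamΦ (N := Lc ^ (n + 1 + 1 + 1)) α x' l (legPt Lc (Sum.inl l) w i)) -
            ((Lc : ℝ) ^ (n + 1 + 1)) ^ (3 + 2) * GamΦ (N := Lc ^ (n + 1 + 1)) α x' l w|
          ≤ c' * θ' ^ (n + 1) * Real.exp (-κ' * l1 (x' - quo (Lc ^ (n + 1 + 1)) w))) := by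
  obtain ⟨c', θ', κ', h0, h1, h2, h3, hD⟩ := exists_dec_cauchy_of_cellMean (d := 3) hLc hc hθ0 hθ1 hκ₁ hC
  refine ⟨c', θ', κ', h0, h1, h2, h3, fun n k l u u' => ?_, fun n α l x' w => ?_⟩
  · -- vertex / right leg: (D) at `z := u − N•u′`, leg type `inl k`; then align the syntax (no `rfl` through `wH`)
    have h := hD (n + 1) k l (u - (((Lc ^ (n + 1 + 1) : ℕ) : ℤ)) • u') (Sum.inl k)
    rw [quo_sub_zsmul] at h
    rw [show n + 1 + 2 = n + 1 + 1 + 1 from rfl] at h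
    simp only [legPt_sub_zsmul] at h
    exact h
  · -- left leg: `GamΦ = −wHᵀ` at both levels, (D) at `z := w − N•x′`, leg type `inl l`
    have h := hD (n + 1) l α (w - (((Lc ^ (n + 1 + 1) : ℕ) : ℤ)) • x') (Sum.inl l)
    rw [quo_sub_zsmul, l1_sub_symm] at h
    rw [show n + 1 + 2 = n + 1 + 1 + 1 from rfl] at h
    simp only [legPt_sub_zsmul] at h
    simp only [GamΦ_eq_neg_wH, mul_neg, Finset.sum_neg_distrib]
    rw [← neg_sub', abs_neg]
    exact h


omit [NeZero Lc] in
/-- [folklore] The next level's block label is this level's block label of the `Lc`-block label: `quo (Lc^(m+1)) u = quo (Lc^m) (quo Lc u)`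
(`ScaleNesting.quo_mul`). -/
theorem quo_pow_succ_eq (m : ℕ) (u : Fin (3 + 1) → ℤ) : quo (Lc ^ (m + 1)) u = quo (Lc ^ m) (quo Lc u) := by
  rw [pow_succ']; exact quo_mul Lc (Lc ^ m) u

omit [NeZero Lc] in
/-- [folklore] Site algebra of the block sample: `Lc•(quo Lc u − N•u′) + (u − Lc•quo Lc u) = u − (N·Lc)•u′`, casts as in the rows. -/
theorem site_blockSample_eq (n : ℕ) (u u' : Fin (3 + 1) → ℤ) :
    (Lc : ℤ) • (quo Lc u - (((Lc ^ (n + 1 + 1) : ℕ) : ℤ)) • u') + (u - (Lc : ℤ) • quo Lc u) =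
      u - (((Lc ^ (n + 1 + 1 + 1) : ℕ) : ℤ)) • u' := by
  rw [smul_sub, smul_smul]
  have e : ((Lc : ℤ) * (((Lc ^ (n + 1 + 1) : ℕ) : ℤ))) = (((Lc ^ (n + 1 + 1 + 1) : ℕ) : ℤ)) := by push_cast; ring
  rw [e]; abel

/-- [folklore] **THE THREE BLOCK-SAMPLED LEG DIFFERENCES AT `d = 3`** (ROW indexing; the dW row's coupling shape, leaf-15-g14 CLAIMS l.5425 —
`|G₁ l w − G l (quo Lc w)| ≤ ε_n·e^{−δ|quo_{N′} w − x′|₁}` for each leg, member `n+3`'s leg at the fine site against member `n+2`'s at its `Lc`-block):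
(vertex/right) `|N′^5·wH_{N′} k l (u − N′•u′) − N^5·wH_N k l (quo Lc u − N•u′)| ≤ c′·θ′^{n+1}·e^{−κ′|quo_{N′} u − u′|₁}` and
(left) `|N′^5·GamΦ_{N′} α x′ l w − N^5·GamΦ_N α x′ l (quo Lc w)| ≤ c′·θ′^{n+1}·e^{−κ′|x′ − quo_{N′} w|₁}`, from the cell-MEAN «(N1-Cauchy)» (hypothesis)
and the TREE's (N1′); sup only — no gradient of a difference. -/
theorem sampleLegs_three_of_cellMean (hLc : 2 ≤ Lc) {c θ κ₁ : ℝ} (hc : 0 ≤ c) (hθ0 : 0 ≤ θ) (hθ1 : θ < 1) (hκ₁ : 0 < κ₁)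
    (hC : ∀ (n : ℕ) (κ l : Fin (3 + 1)) (z : Fin (3 + 1) → ℤ),
      |((Lc : ℝ) ^ (3 + 1))⁻¹ * ∑ r ∈ box (3 + 1) Lc,
            ((Lc : ℝ) ^ (n + 2)) ^ (3 + 2) * wH (N := Lc ^ (n + 2)) κ l ((Lc : ℤ) • z + toSite r) -
          ((Lc : ℝ) ^ (n + 1)) ^ (3 + 2) * wH (N := Lc ^ (n + 1)) κ l z| ≤
        c * θ ^ n * Real.exp (-κ₁ * l1 (quo (Lc ^ (n + 1)) z))) :
    ∃ c' θ' κ' : ℝ, 0 ≤ c' ∧ 0 ≤ θ' ∧ θ' < 1 ∧ 0 < κ' ∧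
      (∀ (n : ℕ) (k l : Fin (3 + 1)) (u u' : Fin (3 + 1) → ℤ),
        |((Lc : ℝ) ^ (n + 1 + 1 + 1)) ^ (3 + 2) *
              wH (N := Lc ^ (n + 1 + 1 + 1)) k l (u - (((Lc ^ (n + 1 + 1 + 1) : ℕ) : ℤ)) • u') -
            ((Lc : ℝ) ^ (n + 1 + 1)) ^ (3 + 2) *
              wH (N := Lc ^ (n + 1 + 1)) k l (quo Lc u - (((Lc ^ (n + 1 + 1) : ℕ) : ℤ)) • u')|
          ≤ c' * θ' ^ (n + 1) * Real.exp (-κ' * l1 (quo (Lc ^ (n + 1 + 1 + 1)) u - u'))) ∧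
      (∀ (n : ℕ) (α l : Fin (3 + 1)) (x' w : Fin (3 + 1) → ℤ),
        |((Lc : ℝ) ^ (n + 1 + 1 + 1)) ^ (3 + 2) * GamΦ (N := Lc ^ (n + 1 + 1 + 1)) α x' l w -
            ((Lc : ℝ) ^ (n + 1 + 1)) ^ (3 + 2) * GamΦ (N := Lc ^ (n + 1 + 1)) α x' l (quo Lc w)|
          ≤ c' * θ' ^ (n + 1) * Real.exp (-κ' * l1 (x' - quo (Lc ^ (n + 1 + 1 + 1)) w))) := by
  obtain ⟨c', θ', κ', h0, h1, h2, h3, hP⟩ := exists_sample_cauchy_of_cellMean (d := 3) hLc hc hθ0 hθ1 hκ₁ hC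
  have hv : ∀ u : Fin (3 + 1) → ℤ, l1 (u - (Lc : ℤ) • quo Lc u) ≤ 2 * (3 + 1) * Lc := by
    intro u
    have h := l1_sub_zsmul_quo_le (d := 3) Lc u
    have : (0 : ℝ) ≤ (3 + 1) * Lc := by positivity
    push_cast at h ⊢
    linarith
  refine ⟨c', θ', κ', h0, h1, h2, h3, fun n k l u u' => ?_, fun n α l x' w => ?_⟩
  · have h := hP (n + 1) k l (quo Lc u - (((Lc ^ (n + 1 + 1) : ℕ) : ℤ)) • u') (u - (Lc : ℤ) • quo Lc u) (hv u)
    rw [site_blockSample_eq, quo_sub_zsmul, ← quo_pow_succ_eq] at h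
    rw [show n + 1 + 2 = n + 1 + 1 + 1 from rfl] at h
    exact h
  · have h := hP (n + 1) l α (quo Lc w - (((Lc ^ (n + 1 + 1) : ℕ) : ℤ)) • x') (w - (Lc : ℤ) • quo Lc w) (hv w)
    rw [site_blockSample_eq, quo_sub_zsmul, ← quo_pow_succ_eq, l1_sub_symm] at h
    rw [show n + 1 + 2 = n + 1 + 1 + 1 from rfl] at h
    rw [GamΦ_eq_neg_wH, GamΦ_eq_neg_wH, mul_neg, mul_neg, ← neg_sub', abs_neg]
    exact h

end Three

end Summit.QuantumFields.BalabanUV.Beta.GAN24.FineReadoutCauchyDecLegs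

end
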